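import Mathlib.Analysis.Calculus.ImplicitFunction.ProdDomain
import Mathlib.Analysis.SpecificLimits.Normed
import HarnessLib

/-!
# Differentiable dependence of fixed points on parameters (from the implicit function theorem)

Auxiliary (folklore) file of the series formalising [BBS-rg-flow] (Bauerschmidt–Brydges–Slade, AHP 16
(2015), arXiv:1211.2477) towards `Literature.Barriers.CriticalPhenomena.WeaklySAWFourDimLogCorrections`:
the abstract `C¹`-part of the uniform contraction principle, which is what Theorem 1.4(ii) (smooth
dependence of the critical flow — the fixed point of the flow map `T` of `WeaklySAWFlowMap.lean` — on the
initial condition `g₀`) needs on top of the differentiability of `T`.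

* `isInvertible_id_sub_of_norm_lt_one`: `1 - A` is invertible for `‖A‖ < 1` (`Units.oneSub`);
* `hasStrictFDerivAt_fixedPoint`: if `T : P × X → X` (Banach spaces) is strictly differentiable at
  `(p₀, x(p₀))`, `T(p, x(p)) = x(p)` for `p` near `p₀`, `x` is continuous at `p₀` and `1 - D_xT` is
  invertible, then `x` is strictly differentiable at `p₀` with `Dx(p₀) = (1 - D_xT)⁻¹D_pT` — by Mathlib's
  implicit function theorem on a product domain (`HasStrictFDerivAt.implicitFunctionOfProdDomain`) and
  its local uniqueness.

## References
* R. Bauerschmidt, D. C. Brydges, G. Slade, arXiv:1211.2477, Theorem 1.4(ii) and Lemma 3.4 (smoothness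
  of the flow in the initial condition). [BauerschmidtBrydgesSlade2015Flow]
-/

noncomputable section

open Filter Topology Set

namespace Literature.Barriers.CriticalPhenomena

namespace CTWSAW

/-! ## Differentiable dependence of the fixed point of a parametrised contraction (via the implicit
function theorem) -/

section FixedPointCalculus

variable {P X : Type*} [NormedAddCommGroup P] [NormedSpace ℝ P] [CompleteSpace P]
  [NormedAddCommGroup X] [NormedSpace ℝ X] [CompleteSpace X]

/-- `1 - A` is invertible for `‖A‖ < 1` (Neumann series). [folklore] -/
theorem isInvertible_id_sub_of_norm_lt_one {A : X →L[ℝ] X} (h : ‖A‖ < 1) :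
    (ContinuousLinearMap.id ℝ X - A).IsInvertible := by
  set u : (X →L[ℝ] X)ˣ := Units.oneSub A h with hu
  have hval : (u : X →L[ℝ] X) = ContinuousLinearMap.id ℝ X - A := by
    rw [hu, Units.val_oneSub]; rfl
  refine ContinuousLinearMap.IsInvertible.of_inverse (g := ((u⁻¹ : (X →L[ℝ] X)ˣ) : X →L[ℝ] X)) ?_ ?_
  · rw [← hval]; exact u.mul_inv
  · rw [← hval]; exact u.inv_mul

/-- **Strict differentiability of the fixed point of a parametrised map** (the uniform contraction
principle, `C¹` part, deduced from the implicit function theorem): if `T : P × X → X` is strictly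
differentiable at `(p₀, x(p₀))`, `x(p)` is a fixed point of `T(p, ·)` for `p` near `p₀`, `p ↦ x(p)` is
continuous at `p₀`, and `1 - D_xT` is invertible (e.g. `‖D_xT‖ < 1`), then `x` is strictly differentiable
at `p₀` with derivative `(1 - D_xT)⁻¹ D_pT`. [folklore] -/
theorem hasStrictFDerivAt_fixedPoint {T : P × X → X} {T' : P × X →L[ℝ] X} {p₀ : P} {x : P → X}
    (hT : HasStrictFDerivAt T T' (p₀, x p₀)) (hfix : ∀ᶠ p in 𝓝 p₀, T (p, x p) = x p)
    (hcont : ContinuousAt x p₀)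
    (hinv : (ContinuousLinearMap.id ℝ X - T' ∘L ContinuousLinearMap.inr ℝ P X).IsInvertible) :
    HasStrictFDerivAt x
      ((ContinuousLinearMap.id ℝ X - T' ∘L ContinuousLinearMap.inr ℝ P X).inverse ∘L
        (T' ∘L ContinuousLinearMap.inl ℝ P X)) p₀ := by
  -- the implicit equation `f(p, y) = y - T(p, y) = 0`
  set f : P × X → X := fun v => v.2 - T v with hf_def
  set f' : P × X →L[ℝ] X := ContinuousLinearMap.snd ℝ P X - T' with hf'_def
  have hf : HasStrictFDerivAt f f' (p₀, x p₀) := hasStrictFDerivAt_snd.sub hT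
  have hinr : f' ∘L ContinuousLinearMap.inr ℝ P X = ContinuousLinearMap.id ℝ X - T' ∘L ContinuousLinearMap.inr ℝ P X := by
    ext y; simp [hf'_def]
  have hinl : f' ∘L ContinuousLinearMap.inl ℝ P X = -(T' ∘L ContinuousLinearMap.inl ℝ P X) := by
    ext p; simp [hf'_def]
  have hinv' : (f' ∘L ContinuousLinearMap.inr ℝ P X).IsInvertible := by rw [hinr]; exact hinv
  -- the implicit function and its local uniqueness
  have hψ := hf.hasStrictFDerivAt_implicitFunctionOfProdDomain hinv'
  have huniq := hf.eventually_apply_eq_iff_implicitFunctionOfProdDomain hinv'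
  have hfu : f (p₀, x p₀) = 0 := by
    have := hfix.self_of_nhds
    simp [hf_def, this]
  -- `x` agrees with the implicit function near `p₀`
  have htend : Tendsto (fun p => (p, x p)) (𝓝 p₀) (𝓝 (p₀, x p₀)) :=
    (continuous_id.tendsto p₀).prodMk_nhds hcont.tendsto
  have heq : x =ᶠ[𝓝 p₀] hf.implicitFunctionOfProdDomain hinv' := by
    have h1 := htend.eventually huniq
    filter_upwards [h1, hfix] with p hp hfp
    have hfp0 : f (p, x p) = f (p₀, x p₀) := by rw [hfu]; simp [hf_def, hfp]
    exact (hp.1 hfp0).symm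
  -- transfer the derivative
  have hderiv : -(f' ∘L ContinuousLinearMap.inr ℝ P X).inverse ∘L (f' ∘L ContinuousLinearMap.inl ℝ P X) =
      (ContinuousLinearMap.id ℝ X - T' ∘L ContinuousLinearMap.inr ℝ P X).inverse ∘L (T' ∘L ContinuousLinearMap.inl ℝ P X) := by
    rw [hinr, hinl]; ext p; simp
  rw [← hderiv]
  exact hψ.congr_of_eventuallyEq heq.symm

end FixedPointCalculus


end CTWSAW

end Literature.Barriers.CriticalPhenomena
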